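import Summits.BirchSwinnertonDyer.BirchSwinnertonDyer.Theorems.SmallImageMuTransferMuTransferX9LocalTransversePerfect
import Summits.BirchSwinnertonDyer.BirchSwinnertonDyer.Theorems.KatoDescentPotSupersingularUnramifiedLocalConditionSelfDual
import HarnessLib

/-!
# Route `ByReductionTypeAtTwo`, crux `OrdKatoHalfAtTwoIso` (stmt-BirchSwinnertonDyer-19573), line
# `steinberg-fibre-at-two` (skeleton v5): helper W3d (trunk T2 = sidea-stub_port-2 (H-P)) — `tr × ur`
# PERFECTNESS of the local Tate pairing at a PRIME-POWER `n` (the case `n = 2^k` included)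

HONEST FRAMING (cell bsd-2adic): BSD is not proved by any of this; the crux `OrdKatoHalfAtTwoIso` is NOT
proved here; none of the line's registered stubs is proved here; nothing is booked.  This file is a KERNEL
HELPER (`--supports … --as helper`; it is not one of the line's registered stubs) for step K4 — the `q`-term
of the Poitou–Tate sum `Σ_v ⟨κ_q, Ψ⟩_v = 0` at the transposition prime `q` — of the registered stub
`stub_HK_kolyvaginRankOneTwo` of the line `Cruxes/OrdKatoHalfAtTwoIso/Lines/steinberg_fibre_at_two.lean`.
The statement was typed by the side seat sidea-stub_port-2 as (H-P) (`STUB_IDEAS_stub_port_2_Helpers.lean`;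
credit: sidea-stub_port-2, critic scrit π3 «H17 superseded by H-P») and is proved here.  ONE THEOREM (no
definition, no named fact, no `sorry`): a TOOL theorem of local Galois cohomology relative to a family
`inv : LocalInvariants K n` (perfectness enters as the hypothesis `inv.IsPerfect`, as everywhere in the
duality layer; it is supplied in the tree only by the Poitou–Tate facts).

## What

**`SteinbergFibreAtTwo.eq_zero_of_mem_transverse_of_forall_unramified_pairing_eq_zero_primePow`** — `K` a
number field, `M` a finite discrete `Γ_K`-module killed by the PRIME POWER `n`, `v ∤ n` a finite place at
which the inertia group acts trivially on `M` and on which the mod-`ℓ` cyclotomic character is onto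
`(ℤ/ℓ)ˣ` already on inertia (`K_v(μ_ℓ)/K_v` totally ramified), `inv` a perfect family: a class
`a ∈ H¹(K_v, M)` that is `K_v(μ_ℓ)`-TRANSVERSE and pairs to zero with every UNRAMIFIED class of
`H¹(K_v, M^D)` is zero — the `tr × ur` local Tate pairing `H¹_tr(K_v, M) × H¹_ur(K_v, M^D) → ℤ/n` is
non-degenerate on the transverse side, for `n = 2^k` as well.

## Why a new proof at `2`

The odd twin `LocalSplitPrime.eq_zero_of_mem_transverse_of_forall_unramified_pairing_eq_zero`
(`…SmallImageMuTransferMuTransferX9LocalTransversePerfect`, hypothesis `Odd n`) argues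
`tr ⊥ tr` + `H¹ = H¹_ur + H¹_tr` (for `M^D`) + perfectness; `tr ⊥ tr` FAILS for even `n`
(`(ϖ, ϖ)_2 = (−1)^{(q−1)/2}`).  The `2`-adic-safe route (H-P), three tree theorems composed:
(i) `ur^⊥ ⊆ ur` — a class annihilating `H¹_ur(K_v, M^D)` is unramified, for EVERY finite `n`-torsion `M`
at `v ∤ n`, prime-power `n`, perfect family (Milne I Thm. 2.6 by counting, no unramified-module hypothesis:
`UnramifiedSelfDual.mem_unramifiedSubgroup_of_forall_pairing_eq_zero`); (ii) `ur ⊓ tr = ⊥`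
(`LocalSplitPrime.unramifiedSubgroup_inf_transverseSubgroup_cyclotomicField_eq_bot`: `Γ_{K_v} = I · ker χ̄_ℓ`,
so an unramified cocycle principal on `ker χ̄_ℓ` is principal); (iii) `a ∈ ur ⊓ tr = ⊥`.  Compared with
the odd twin, no `(ℓ − 1)M = 0`, no `ringChar 𝓀 = ℓ` and no hypothesis on the inertia action on `M^D` is
needed (and `Odd n` is replaced by `IsPrimePow n`, `v ∤ n`).

References: B. Mazur, K. Rubin, *Kolyvagin systems*, Mem. AMS 799 (2004) §1.2, Lemma 1.2.4, Prop. 1.3.2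
[MazurRubin2004]; J. S. Milne, *Arithmetic Duality Theorems* (2nd ed., 2006) I Thm. 2.6 [MilneADT2006];
K. Rubin, *Euler Systems*, Ann. of Math. Stud. 147 (2000) Lemma 1.4.7 [Rubin2000]; L. C. Washington,
«Galois cohomology», in Cornell–Silverman–Stevens, *Modular Forms and Fermat's Last Theorem* (1997),
Thm. 1 (c), p. 162; tree: `…X9LocalTransversePerfect` (odd twin, cell bsd-smallim),
`…KatoDescentPotSupersingularUnramifiedLocalConditionSelfDual` (Milne I 2.6 without the unramified
hypothesis, cell bsd-potss), `…X9LocalTransverse` (`ur ⊓ tr = ⊥`).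
-/

-- the summit and its single problem are both named `BirchSwinnertonDyer` (registry layout D-0017)
set_option linter.dupNamespace false
set_option autoImplicit false

noncomputable section

open scoped Classical NumberField

universe u

namespace Summit.BirchSwinnertonDyer.BirchSwinnertonDyer.Theorems.SteinbergFibreAtTwo

open Field IsDedekindDomain NumberField
open Literature.NumberTheory.GaloisRepresentations
open Literature.NumberTheory.GaloisCohomology
open Summit.BirchSwinnertonDyer.BirchSwinnertonDyer.Rank1Residual

/-- **A transverse class pairing to zero with every unramified dual class is zero, `n` a PRIME POWER**
(`n = 2^k` included).  `K` a number field, `M` a finite discrete `Γ_K`-module with `n • M = 0`, `v ∤ n` a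
finite place with the inertia group `I ≤ Γ_{K_v}` acting trivially on `M` and `χ̄_ℓ(I) = (ℤ/ℓ)ˣ`, `inv` a
perfect family of local invariants: if `a ∈ H¹_tr(K_v, M)` (transverse for `K_v(μ_ℓ)`) and
`⟨a, b⟩_v = 0` for every `b ∈ H¹_ur(K_v, M^D)`, then `a = 0`.  Proof: `a` is unramified
(`ur^⊥ ⊆ ur`, Milne I Thm. 2.6 by counting at prime-power `n`:
`UnramifiedSelfDual.mem_unramifiedSubgroup_of_forall_pairing_eq_zero`), and `H¹_ur ⊓ H¹_tr = ⊥`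
(`LocalSplitPrime.unramifiedSubgroup_inf_transverseSubgroup_cyclotomicField_eq_bot`).
[cite: MazurRubin2004, Lemma 1.2.4 / §1.2] [cite: MilneADT2006, Ch. I, Thm. 2.6]
[cite: Rubin2000, Lemma 1.4.7] -/
theorem eq_zero_of_mem_transverse_of_forall_unramified_pairing_eq_zero_primePow
    {K : Type u} [Field K] [NumberField K] {M : Type u} [AddCommGroup M] [TopologicalSpace M]
    [DiscreteTopology M] [Finite M] (ρ : DiscreteGaloisModule K M) {n : ℕ} [NeZero n]
    (inv : LocalInvariants K n) (v : HeightOneSpectrum (𝓞 K)) (ℓ : ℕ) [Fact ℓ.Prime]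
    [NeZero ((ℓ : ℕ) : v.adicCompletion K)]
    (hn : IsPrimePow n) (hperf : inv.IsPerfect) (hMn : ∀ m : M, n • m = 0)
    (hv : ((n : ℕ) : 𝓞 K) ∉ v.asIdeal)
    (hI : ∀ t ∈ absInertia (v.adicCompletion K), ∀ m : M, GaloisRep.toLocal v ρ t m = m)
    (hχI : ∀ u : (ZMod ℓ)ˣ, ∃ t ∈ absInertia (v.adicCompletion K),
      modPCyclotomicCharacterZMod (v.adicCompletion K) ℓ t = u)
    {a : galoisCohomology (GaloisRep.toLocal v ρ) 1}
    (ha : a ∈ DiscreteGaloisModule.transverseSubgroup (GaloisRep.toLocal v ρ)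
      (CyclotomicField ℓ (v.adicCompletion K)))
    (h0 : ∀ b ∈ DiscreteGaloisModule.unramifiedSubgroup (GaloisRep.toLocal v (ρ.tateDual n)) 1,
      DiscreteGaloisModule.localTatePairingZMod ρ n (Sum.inr v) (inv (Sum.inr v)) a b = 0) :
    a = 0 := by
  -- (i) `ur^⊥ ⊆ ur`: `a` annihilates `H¹_ur(K_v, M^D)`, hence is unramified (prime-power `n`, `v ∤ n`)
  have hur : a ∈ DiscreteGaloisModule.unramifiedSubgroup (GaloisRep.toLocal v ρ) 1 :=
    UnramifiedSelfDual.mem_unramifiedSubgroup_of_forall_pairing_eq_zero inv hn hperf ρ hMn v hv h0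
  -- (ii) `H¹_ur ⊓ H¹_tr = ⊥` (inertia trivial on `M`, `χ̄_ℓ` onto on inertia)
  have hbot := LocalSplitPrime.unramifiedSubgroup_inf_transverseSubgroup_cyclotomicField_eq_bot
    (GaloisRep.toLocal v ρ) ℓ hI hχI
  -- (iii) `a ∈ H¹_ur ⊓ H¹_tr = ⊥`
  have hmem : a ∈ DiscreteGaloisModule.unramifiedSubgroup (GaloisRep.toLocal v ρ) 1 ⊓
      DiscreteGaloisModule.transverseSubgroup (GaloisRep.toLocal v ρ)
        (CyclotomicField ℓ (v.adicCompletion K)) :=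
    AddSubgroup.mem_inf.2 ⟨hur, ha⟩
  rw [hbot] at hmem
  exact AddSubgroup.mem_bot.1 hmem

end Summit.BirchSwinnertonDyer.BirchSwinnertonDyer.Theorems.SteinbergFibreAtTwo

end
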